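import Summits.HubbardSuperconductivity.HubbardSuperconductivity.Theses.AposterioriCapRg
import Summits.HubbardSuperconductivity.HubbardSuperconductivity.Theorems.AposterioriCapRgCapRgSymmetricCertificatePinnedStubCooperC4v
import Summits.HubbardSuperconductivity.HubbardSuperconductivity.Theorems.AposterioriCapRgCapRgSymmetricCertificatePinnedStubDominanceOfMargins

/-!
# Crux `CapRgSymmetricCertificatePinned` (stmt-HubbardSuperconductivity-14045), line `strict-continuum-certificate-transfer`
# (v4): stub `stub_certificateOfPerAccuracy` — the crux's certificate conjunct at `(U, μ)` from the per-accuracy block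

Support file (`--supports stmt-HubbardSuperconductivity-14045`; registered stub `stub_certificateOfPerAccuracy` of the lead's
skeleton v4; no definition).  This is the composition of skeleton v3 (first lead seat), factored as a theorem: IF at
`(U, μ)`, FOR EVERY mismatch tolerance `c > 0`, there are an admissible frame `K : TrigPolyC4v` and an admissible scale `Λ`
with the pinned shell geometry such that, eventually along `M → ∞`, then `β → ∞`, then `L → ∞` (torus side `L + 1`,
`2(M + 1)` Matsubara frequencies), the Fermi-curve mismatch of `hubbardEffectiveActionCT` is `< c + ½|e_K|` on the shell,
the `d`-wave pairing strength converges to an interior window value `lam ∈ (1/8, 1/5)`, and the remaining clauses hold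
STRICTLY (normaliser `≠ 0`, field strengths in `(ζ, 1/ζ)`, `‖𝒱₄‖_∞ < E₁`, truncated remainder `< E₃`, Stoner products
`< 1 − σ`, strict `B₁g` isotypic gap (G), half-bottom second Rayleigh level (H4)), THEN for every tolerance
`Θ = (c₀, w)` there are `K, Λ, L₀` with `symmetricRegimeCertificateT U μ capRgCornerDataT Θ K Λ L₀` — the certificate
conjunct of the crux at `(U, μ)`.  Proof: take `c := c₀ · Λ₁` (`Λ₁ = 1/100 ≤ Λ`), a rational enclosure of width `≤ w`
around `lam` (`rationalEnclosure_of_mem_Ioo`), `L₀, β₀(L), M₀(L, β)` from the eventualities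
(`thermodynamicBlock_of_eventually`); strict margins give the non-strict clauses, and (G)+(H4)+`D₄`-covariance give
`CooperDominance` by the landed stubs `stub_dominanceOfMargins` (p85399) and `stub_cooperC4v` (p89297).  [folklore logic
over the tree's definitions; the a-posteriori format of Figueras–Haro–Luque 2016 Thm. 2.5.]
-/

noncomputable section

namespace Summit.HubbardSuperconductivity.CapRgSymmetricCertificatePinned.StrictContinuum

open Filter Topology
open Literature.MathematicalPhysics.QuantumLattice Literature.Probability.LatticeModels Matrix
open scoped BigOperators

/-- **An interior window value has rational enclosures of every width**: for `x ∈ (1/8, 1/5)` and a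
rational `w > 0` there are rationals `1/8 ≤ a < x < b ≤ 1/5` with `b - a ≤ w`. -/
theorem rationalEnclosure_of_mem_Ioo {x : ℝ} (hlo : (symmetricWindowLower : ℝ) < x)
    (hhi : x < symmetricWindowUpper) {w : ℚ} (hw : 0 < w) :
    ∃ a b : ℚ, symmetricWindowLower ≤ a ∧ a ≤ b ∧ b ≤ symmetricWindowUpper ∧ b - a ≤ w ∧
      (a : ℝ) < x ∧ x < b := by
  have hw' : (0 : ℝ) < w := by exact_mod_cast hw
  obtain ⟨a, ha1, ha2⟩ := exists_rat_btwn (max_lt hlo (show x - w / 2 < x by linarith))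
  obtain ⟨b, hb1, hb2⟩ := exists_rat_btwn (lt_min hhi (show x < x + w / 2 by linarith))
  have ha1' : ((symmetricWindowLower : ℚ) : ℝ) < a := lt_of_le_of_lt (le_max_left _ _) ha1
  have ha1'' : x - w / 2 < a := lt_of_le_of_lt (le_max_right _ _) ha1
  have hb2' : (b : ℝ) < symmetricWindowUpper := lt_of_lt_of_le hb2 (min_le_left _ _)
  have hb2'' : (b : ℝ) < x + w / 2 := lt_of_lt_of_le hb2 (min_le_right _ _)
  refine ⟨a, b, ?_, ?_, ?_, ?_, ha2, hb1⟩
  · exact_mod_cast ha1'.le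
  · exact_mod_cast (ha2.trans hb1).le
  · exact_mod_cast hb2'.le
  · have : (b : ℝ) - a ≤ w := by linarith
    exact_mod_cast this

/-- Filter bookkeeping: an `atTop`-eventual property of `L + 1`, `β`, `M + 1` yields the crux's
`∃ L₀ ∀ L ≥ L₀ [NeZero L] ∃ β₀ ∀ β ≥ β₀ ∃ M₀ ∀ M ≥ M₀ [NeZero M]` block. -/
theorem thermodynamicBlock_of_eventually {P : ∀ (L : ℕ) [NeZero L], ℝ → ∀ (M : ℕ) [NeZero M], Prop}
    (h : ∀ᶠ L : ℕ in atTop, ∀ᶠ β : ℝ in atTop, ∀ᶠ M : ℕ in atTop, P (L + 1) β (M + 1)) :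
    ∃ L₀ : ℕ, ∀ L : ℕ, L₀ ≤ L → ∀ [NeZero L], ∃ β₀ : ℝ, ∀ β : ℝ, β₀ ≤ β →
      ∃ M₀ : ℕ, ∀ M : ℕ, M₀ ≤ M → ∀ [NeZero M], P L β M := by
  obtain ⟨L₀, hL₀⟩ := eventually_atTop.1 h
  refine ⟨L₀ + 1, fun L hL _ => ?_⟩
  obtain ⟨L', rfl⟩ : ∃ L', L = L' + 1 := ⟨L - 1, by omega⟩
  obtain ⟨β₀, hβ₀⟩ := eventually_atTop.1 (hL₀ L' (by omega))
  refine ⟨β₀, fun β hβ => ?_⟩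
  obtain ⟨M₀, hM₀⟩ := eventually_atTop.1 (hβ₀ β hβ)
  refine ⟨M₀ + 1, fun M hM _ => ?_⟩
  obtain ⟨M', rfl⟩ : ∃ M', M = M' + 1 := ⟨M - 1, by omega⟩
  exact hM₀ M' (by omega)

/-- **Stub `stub_certificateOfPerAccuracy`**: the per-accuracy block at `(U, μ)` implies the crux's certificate
conjunct at `(U, μ)` — for every tolerance `Θ` a frame `K`, a scale `Λ` and a threshold `L₀` with
`symmetricRegimeCertificateT U μ capRgCornerDataT Θ K Λ L₀`. -/
theorem stub_certificateOfPerAccuracy : ∀ (U μ : ℝ),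
    (∀ c : ℝ, 0 < c → ∃ (K : TrigPolyC4v) (Λ : ℝ),
        capRgCornerDataT.AdmitsFrameNorm (K.coeffNorm capRgCornerDataT.frameDecay) ∧
        capRgCornerDataT.AdmitsScale Λ ∧
        ShellGeometry (renormalisedBandC μ K) Λ capRgCornerDataT.velLower capRgCornerDataT.velUpper
          capRgCornerDataT.curvLower capRgCornerDataT.curvUpper capRgCornerDataT.vanHoveDist ∧
        (∀ᶠ L : ℕ in atTop, ∀ᶠ β : ℝ in atTop, ∀ᶠ M : ℕ in atTop,
          ∀ k ∈ momentumShell (L + 1) (nambuXiCT (L + 1) μ K) Λ, ∀ σ : Fin 2,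
            |(selfEnergy (L + 1) (M + 1) β (hubbardEffectiveActionCT (L + 1) (M + 1) β U μ 0 K Λ)
                (omega0 (M + 1), k) σ).re| <
              c + capRgCornerDataT.slopeAllowance * |nambuXiCT (L + 1) μ K k|) ∧
        (∃ lam : ℝ, ((symmetricWindowLower : ℝ) < lam ∧ lam < symmetricWindowUpper) ∧
          ∀ η : ℝ, 0 < η → ∀ᶠ L : ℕ in atTop, ∀ᶠ β : ℝ in atTop, ∀ᶠ M : ℕ in atTop,
            |pairingStrength (L + 1) (M + 1) β (nambuXiCT (L + 1) μ K) Λ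
                (hubbardEffectiveActionCT (L + 1) (M + 1) β U μ 0 K Λ) - lam| < η) ∧
        (∀ᶠ L : ℕ in atTop, ∀ᶠ β : ℝ in atTop, ∀ᶠ M : ℕ in atTop,
          hubbardEffPartitionFnCT (L + 1) (M + 1) β U μ 0 K Λ ≠ 0 ∧
          (∀ k ∈ momentumShell (L + 1) (nambuXiCT (L + 1) μ K) Λ, ∀ σ : Fin 2,
            (capRgCornerDataT.fieldFloor : ℝ) <
                fieldStrengthSpin (L + 1) (M + 1) β (hubbardEffectiveActionCT (L + 1) (M + 1) β U μ 0 K Λ) k σ ∧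
              fieldStrengthSpin (L + 1) (M + 1) β (hubbardEffectiveActionCT (L + 1) (M + 1) β U μ 0 K Λ) k σ <
                1 / capRgCornerDataT.fieldFloor) ∧
          vertexSupNorm (L + 1) (M + 1) β (hubbardEffectiveActionCT (L + 1) (M + 1) β U μ 0 K Λ) 4 <
            capRgCornerDataT.quarticBound ∧
          remainderWeightNormUpTo (L + 1) (M + 1) capRgCornerDataT.remainderDegree β
              ((capRgCornerDataT.fieldRadius : ℝ) ^ 2 * Λ)
              (hubbardEffectiveActionCT (L + 1) (M + 1) β U μ 0 K Λ) < capRgCornerDataT.remainderBound ∧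
          (∀ q : TorusSite 2 (L + 1),
            stonerCharge (L + 1) (M + 1) β (nambuXiCT (L + 1) μ K) Λ
                (hubbardEffectiveActionCT (L + 1) (M + 1) β U μ 0 K Λ) q < 1 - capRgCornerDataT.stonerMargin ∧
              stonerSpin (L + 1) (M + 1) β (nambuXiCT (L + 1) μ K) Λ
                (hubbardEffectiveActionCT (L + 1) (M + 1) β U μ 0 K Λ) q < 1 - capRgCornerDataT.stonerMargin) ∧
          (⨅ f : {f : TorusSite 2 (L + 1) → ℂ // star f ⬝ᵥ f = 1 ∧ IsB1g f},
              reRayleigh (cooperMatrix (L + 1) (M + 1) β (nambuXiCT (L + 1) μ K) Λ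
                (hubbardEffectiveActionCT (L + 1) (M + 1) β U μ 0 K Λ)) f.1) <
            ⨅ g : {g : TorusSite 2 (L + 1) → ℂ // star g ⬝ᵥ g = 1 ∧
                ∀ f : TorusSite 2 (L + 1) → ℂ, IsB1g f → star f ⬝ᵥ g = 0},
              reRayleigh (cooperMatrix (L + 1) (M + 1) β (nambuXiCT (L + 1) μ K) Λ
                (hubbardEffectiveActionCT (L + 1) (M + 1) β U μ 0 K Λ)) g.1 ∧
          -(-cooperMatrix (L + 1) (M + 1) β (nambuXiCT (L + 1) μ K) Λ
                (hubbardEffectiveActionCT (L + 1) (M + 1) β U μ 0 K Λ)).supRayleigh / 2 ≤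
            ⨆ f : {f : TorusSite 2 (L + 1) → ℂ // star f ⬝ᵥ f = 1},
              ⨅ g : {g : TorusSite 2 (L + 1) → ℂ // star g ⬝ᵥ g = 1 ∧ star f.1 ⬝ᵥ g = 0},
                reRayleigh (cooperMatrix (L + 1) (M + 1) β (nambuXiCT (L + 1) μ K) Λ
                  (hubbardEffectiveActionCT (L + 1) (M + 1) β U μ 0 K Λ)) g.1)) →
    ∀ Θ : SymmetricTolerance, ∃ (K : TrigPolyC4v) (Λ : ℝ) (L₀ : ℕ),
      symmetricRegimeCertificateT U μ capRgCornerDataT Θ K Λ L₀ := by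
  intro U μ hacc Θ
  -- the mismatch tolerance handed to C⁺′: `c := c₀ · Λ₁ ≤ c₀ · Λ`
  have hc : (0 : ℝ) < Θ.mismatch * capRgCornerDataT.scaleLower :=
    mul_pos (by exact_mod_cast Θ.mismatch_pos) (by exact_mod_cast capRgCornerDataT.scaleLower_pos)
  obtain ⟨K, Λ, hframe, hΛ, hgeom, hmis, ⟨lam, ⟨hlo, hhi⟩, hconv⟩, hblock⟩ := hacc _ hc
  have hcΛ : (Θ.mismatch : ℝ) * capRgCornerDataT.scaleLower ≤ Θ.mismatch * Λ :=
    mul_le_mul_of_nonneg_left hΛ.1 (by exact_mod_cast Θ.mismatch_pos.le)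
  -- the rational enclosure, chosen outside the thermodynamic block
  obtain ⟨a, b, ha, hab, hb, hw, hax, hxb⟩ := rationalEnclosure_of_mem_Ioo hlo hhi Θ.width_pos
  have hη : 0 < min (lam - a) (b - lam) := lt_min (by linarith) (by linarith)
  have hwin := hconv _ hη
  refine ⟨K, Λ, ?_⟩
  -- pointwise, strict margins ⇒ the seven clauses, eventually in `(L, β, M)`
  have hev : ∀ᶠ L : ℕ in atTop, ∀ᶠ β : ℝ in atTop, ∀ᶠ M : ℕ in atTop,
      SymmetricCertifiedAtT capRgCornerDataT Θ a b Λ (L + 1) (M + 1) β (nambuXiCT (L + 1) μ K)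
        (hubbardEffectiveActionCT (L + 1) (M + 1) β U μ 0 K Λ) (hubbardEffPartitionFnCT (L + 1) (M + 1) β U μ 0 K Λ) := by
    refine (hmis.and (hwin.and hblock)).mono fun L hL => ?_
    refine (hL.1.and (hL.2.1.and hL.2.2)).mono fun β hβ => ?_
    refine (hβ.1.and (hβ.2.1.and hβ.2.2)).mono fun M hM => ?_
    obtain ⟨hmis', hwin', hZ, hz, h4, hrem, hst, hgap, hsecond⟩ := hM
    have hwin'' := abs_sub_lt_iff.1 hwin'
    have hlam_a : (a : ℝ) ≤ pairingStrength (L + 1) (M + 1) β (nambuXiCT (L + 1) μ K) Λ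
        (hubbardEffectiveActionCT (L + 1) (M + 1) β U μ 0 K Λ) := by
      have := min_le_left (lam - a) (b - lam); linarith [hwin''.1, hwin''.2]
    have hlam_b : pairingStrength (L + 1) (M + 1) β (nambuXiCT (L + 1) μ K) Λ
        (hubbardEffectiveActionCT (L + 1) (M + 1) β U μ 0 K Λ) ≤ b := by
      have := min_le_right (lam - a) (b - lam); linarith [hwin''.1, hwin''.2]
    have ha_pos : (0 : ℝ) < a := by
      have h18 : ((symmetricWindowLower : ℚ) : ℝ) ≤ a := by exact_mod_cast ha
      have : ((symmetricWindowLower : ℚ) : ℝ) = 1 / 8 := by norm_num [symmetricWindowLower]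
      linarith
    have hneg : -(-cooperMatrix (L + 1) (M + 1) β (nambuXiCT (L + 1) μ K) Λ
        (hubbardEffectiveActionCT (L + 1) (M + 1) β U μ 0 K Λ)).supRayleigh < 0 := by
      have : (a : ℝ) ≤ (-cooperMatrix (L + 1) (M + 1) β (nambuXiCT (L + 1) μ K) Λ
          (hubbardEffectiveActionCT (L + 1) (M + 1) β U μ 0 K Λ)).supRayleigh := hlam_a
      linarith
    have hdom : CooperDominance (cooperMatrix (L + 1) (M + 1) β (nambuXiCT (L + 1) μ K) Λ
        (hubbardEffectiveActionCT (L + 1) (M + 1) β U μ 0 K Λ)) :=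
      stub_dominanceOfMargins (L + 1) _ (fun γ k k' => stub_cooperC4v (L + 1) (M + 1) β U μ Λ K γ k k')
        hgap hneg hsecond
    refine ⟨hZ, fun k hk σ => ?_, fun k hk σ => ⟨(hz k hk σ).1.le, (hz k hk σ).2.le⟩, h4.le, hrem.le,
      ⟨hdom, fun q => ⟨(hst q).1.le, (hst q).2.le⟩⟩, hlam_a, hlam_b⟩
    exact ((hmis' k hk σ).trans_le (by linarith)).le
  obtain ⟨L₀, hL₀⟩ := thermodynamicBlock_of_eventually
    (P := fun L _ β M _ => SymmetricCertifiedAtT capRgCornerDataT Θ a b Λ L M β (nambuXiCT L μ K)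
      (hubbardEffectiveActionCT L M β U μ 0 K Λ) (hubbardEffPartitionFnCT L M β U μ 0 K Λ)) hev
  exact ⟨L₀, hframe, hΛ, hgeom, a, b, ha, hab, hb, hw, hL₀⟩

end Summit.HubbardSuperconductivity.CapRgSymmetricCertificatePinned.StrictContinuum

end
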